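import Summits.FinalStateConjecture.FinalStateConjecture.Theorems.ClusterCompletenessOmegaLimitMultiKerrRecursOfStarEra
import Summits.FinalStateConjecture.FinalStateConjecture.Theorems.ClusterCompletenessOmegaLimitMultiKerrUniqueLimitConvergence
import HarnessLib

/-!
# Route ClusterCompleteness · crux `OmegaLimitMultiKerr` — if every `Cᵏ_loc` ω-limit of a tame star
# hole chart vanishes, its late-time translates CONVERGE to the reference Kerr configuration

Structure lemma for the crux stmt-FinalStateConjecture-14664
(`ClusterCompleteness.OmegaLimitMultiKerr`, rank 9), line `Sketch`, lead gen 6, stub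
`ZeroLimitsConverge` (registered main theorem
`tendsto_supCkENorm_starHole_translate_of_forall_omegaLimit_eq_zero`, closed form).

The LaSalle reading of the recurrence clause of the crux: "the reference Kerr configuration is a
`Cᵏ_loc` ω-limit point of the late-time translates of the era-chart deviation fields". For a hole
chart `Ψ` of the spacetime `𝓢` defined ACROSS the horizon, on the star background
`B★ = starBackground Λ c M a (x ↦ r_a(Λ⁻¹(x − c)))` of `NearKerrLeaf` (domain
`{r(Λ⁻¹(x − c)) > max M 0}`, invariant under translation by the Killing direction
`e = Λ∂₀ = (Λ : E4 ≃L[ℝ] E4) (EuclideanSpace.single 0 1)`, `add_smul_mem_starBackground_domain`;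
star time shifted and radius preserved along `e`,
`KerrSchildChart.time_add_smul / radius_add_smul`), the star deviation
`dev★ = 𝓢.deviationExtend B★ Ψ = Ψ^* g − g_{M,a,Λ,c}` (extended by zero) is `C^∞` on the star domain
(`contDiffOn_deviationExtend_star`, `…StarHoleDictionary`) and TAME after `τ₀` when its `C^{k+1}`
sup norms over the star truncated late regions `{t* > τ₀, r ≤ R}` are finite.

* `tendsto_supCkENorm_starHole_translate_of_forall_omegaLimit_eq_zero` (MAIN, registered) — if
  every `Cᵏ_loc` ω-limit of the translates `dev★ (· + Tₙ • e)`, `Tₙ → +∞`, VANISHES on the star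
  domain, then `supCkENorm K k (dev★ (· + t • e)) → 0` as `t → +∞` THROUGH THE REALS for every
  compact `K` of the star domain: "the only dark limit is the reference Kerr" implies eventual
  `Cᵏ`-closeness to Kerr at every radius (stronger than recurrence). It is EXACTLY the abstract
  `tendsto_supCkENorm_translate_of_forall_omegaLimit_eq_zero` (`…UniqueLimitConvergence`: Hale
  1980, Ch. I, §8, Thm. 8.1 / Lemma 8.2 — a precompact positive semi-orbit whose ω-limit set is one
  point converges to it) for `E = E4`, `W = E4 →L[ℝ] E4 →L[ℝ] ℝ`, `O` the star domain, `e = Λ∂₀`,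
  tameness along `e` on compacts being read off the finite sup norms exactly as in
  `exists_omegaLimit_starHole_translate`: a compact `K` of the star domain has bounded star time
  (`≥ t₀`) and radius (`≤ R₀`) by continuity, so its translates by `t • e`, `t ≥ τ₀ − t₀ + 1`, lie
  in the truncated late region `{t* > τ₀, r ≤ R₀}`, where `norm_iteratedFDeriv_le_toReal_supCkENorm`
  applies.
* `recurs_of_starCharts_of_forall_omegaLimit_eq_zero` (crux-level rider) — the data of
  `Recurs k 𝒟` with star hole charts `Ψsᵢ` (clauses 1–10 verbatim, as in
  `recurs_of_starCharts_of_omegaLimits_flat` of `…RecursOfStarEra`, radius parameter the rest-frame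
  Kerr–Schild radius), TAME after `τ₀`, ALL of whose `Cᵏ_loc` ω-limits vanish on the star domains,
  plus flat-chart recurrence along SOME `T n → ∞`, give `Recurs k 𝒟`: by the main theorem every
  star deviation tends to `0` in `Cᵏ` on compacts through the reals, a fortiori along `T`, with the
  flat ω-limit `g = 0`; then `recurs_of_starCharts_of_omegaLimits_flat`.

Everything is proved; Mathlib + the landed `…RecursOfStarEra` / `…UniqueLimitConvergence` files
only; no definitions.

## References
* J. K. Hale, *Ordinary Differential Equations*, 2nd ed., Krieger 1980, Ch. I §8, Thm. 8.1 and
  Lemma 8.2 (ω-limit sets of bounded orbits; a one-point ω-limit set is the limit; LaSalle's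
  invariance principle). [Hale1980]
* P. Petersen, *Riemannian Geometry*, 2nd ed., GTM 171, Springer 2006, Ch. 10, §3.1
  (`Cᵏ` Arzelà–Ascoli). [Petersen2006]
-/

-- every `Summit.FinalStateConjecture.FinalStateConjecture.…` name repeats the summit = sub-problem segment (D-0017 layout)
set_option linter.dupNamespace false

noncomputable section

open scoped Manifold ContDiff Topology ENNReal
open Set Filter TopologicalSpace

namespace Summit.FinalStateConjecture.FinalStateConjecture.Theorems.ClusterCompleteness

open Literature.Geometry.Lorentzian

/-! ### Zero ω-limits force convergence of the translates of a tame star hole chart -/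

/-- **Registered structure stub (crux stmt-FinalStateConjecture-14664, line `Sketch`, stub
`ZeroLimitsConverge`): if the only `Cᵏ_loc` ω-limit of a tame star hole chart is the reference
Kerr configuration, the late-time translates converge to it.** Let `Ψ` be a smooth chart of the
spacetime `𝓢` on the horizon-penetrating star background
`B★ = starBackground Λ c M a (x ↦ r_a(Λ⁻¹(x − c)))` which is TAME after `τ₀`: the `C^{k+1}` sup norm
of the star deviation `dev★ = Ψ^* g − g_{M,a,Λ,c}` (extended by zero) over every star truncated late
region `{t* > τ₀, r ≤ R}` is finite. If every `Cᵏ` field `g` on the star domain arising as a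
`Cᵏ_loc` limit of translates `dev★ (· + Tₙ • Λ∂₀)` along some `Tₙ → +∞` (convergence in `Cᵏ` on
every compact subset of the star domain) VANISHES on the star domain, then for every compact `K` of
the star domain `supCkENorm K k (dev★ (· + t • Λ∂₀)) → 0` as `t → +∞` through the reals — eventual
`Cᵏ`-closeness to the reference Kerr metric at every radius, across the horizon. Proof: the
abstract one-point-ω-limit-set lemma `tendsto_supCkENorm_translate_of_forall_omegaLimit_eq_zero`
(Hale 1980, Ch. I, §8, Thm. 8.1: subsequence principle plus the `Cᵏ` Arzelà–Ascoli theorem for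
translates) on the open, `Λ∂₀`-invariant star domain (`add_smul_mem_starBackground_domain`), for
the `C^∞` field `dev★` (`contDiffOn_deviationExtend_star`), tame along `Λ∂₀` on compacts: a compact
`K` has star time `≥ t₀` and radius `≤ R₀` (continuity), the star time is shifted and the radius
preserved along `Λ∂₀` (`KerrSchildChart.time_add_smul / radius_add_smul`), so the translates of `K`
by `t ≥ τ₀ − t₀ + 1` lie in `{t* > τ₀, r ≤ R₀}`, where the finite sup norm bounds every derivative
of order `≤ k + 1` (`norm_iteratedFDeriv_le_toReal_supCkENorm`). Closed form.
[cite: Hale1980, Ch. I §8 Thm. 8.1] -/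
theorem tendsto_supCkENorm_starHole_translate_of_forall_omegaLimit_eq_zero :
    ∀ (𝓢 : Spacetime 4) (Λ : lorentzGroup) (c : E4) (M a : ℝ)
      {Ψ : (starBackground Λ c M a fun x ↦ Kerr.radius a (poincareInv Λ c x)).domain → 𝓢.carrier},
      ContMDiff 𝓘(ℝ, E4) (𝓡 4) ∞ Ψ → ∀ {k : ℕ} {τ₀ : ℝ},
      (∀ R : ℝ, supCkENorm (Subtype.val ''
          (starBackground Λ c M a fun x ↦ Kerr.radius a (poincareInv Λ c x)).truncLateRegion τ₀ R)
        (k + 1) (𝓢.deviationExtend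
          (starBackground Λ c M a fun x ↦ Kerr.radius a (poincareInv Λ c x)) Ψ) ≠ ⊤) →
      (∀ (g : E4 → E4 →L[ℝ] E4 →L[ℝ] ℝ) (T : ℕ → ℝ),
        ContDiffOn ℝ k g
          ((starBackground Λ c M a fun x ↦ Kerr.radius a (poincareInv Λ c x)).domain : Set E4) →
        Tendsto T atTop atTop →
        (∀ K ⊆ ((starBackground Λ c M a fun x ↦ Kerr.radius a (poincareInv Λ c x)).domain : Set E4),
          IsCompact K →
          Tendsto (fun n ↦ supCkENorm K k (fun x ↦
            𝓢.deviationExtend (starBackground Λ c M a fun x ↦ Kerr.radius a (poincareInv Λ c x)) Ψ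
              (x + T n • (Λ : E4 ≃L[ℝ] E4) (EuclideanSpace.single (0 : Fin 4) (1 : ℝ))) - g x))
            atTop (𝓝 0)) →
        ∀ x ∈ ((starBackground Λ c M a fun x ↦ Kerr.radius a (poincareInv Λ c x)).domain : Set E4),
          g x = 0) →
      ∀ K ⊆ ((starBackground Λ c M a fun x ↦ Kerr.radius a (poincareInv Λ c x)).domain : Set E4),
        IsCompact K →
        Tendsto (fun t : ℝ ↦ supCkENorm K k (fun x ↦
          𝓢.deviationExtend (starBackground Λ c M a fun x ↦ Kerr.radius a (poincareInv Λ c x)) Ψ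
            (x + t • (Λ : E4 ≃L[ℝ] E4) (EuclideanSpace.single (0 : Fin 4) (1 : ℝ))))) atTop
          (𝓝 0) := by
  intro 𝓢 Λ c M a Ψ hΨ k τ₀ hfin huniq
  -- the star time `t*(x) = (Λ⁻¹(x − c))⁰` is shifted and the radius `r(Λ⁻¹(x − c))` preserved
  have htime : ∀ (x : E4) (s : ℝ),
      (starBackground Λ c M a fun x ↦ Kerr.radius a (poincareInv Λ c x)).time
          (x + s • (Λ : E4 ≃L[ℝ] E4) (EuclideanSpace.single (0 : Fin 4) (1 : ℝ))) =
        (starBackground Λ c M a fun x ↦ Kerr.radius a (poincareInv Λ c x)).time x + s :=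
    KerrSchildChart.time_add_smul Λ c M a
  have hrad : ∀ (x : E4) (s : ℝ),
      (starBackground Λ c M a fun x ↦ Kerr.radius a (poincareInv Λ c x)).radius
          (x + s • (Λ : E4 ≃L[ℝ] E4) (EuclideanSpace.single (0 : Fin 4) (1 : ℝ))) =
        (starBackground Λ c M a fun x ↦ Kerr.radius a (poincareInv Λ c x)).radius x :=
    KerrSchildChart.radius_add_smul Λ c M a
  -- both are continuous
  have htc : Continuous (starBackground Λ c M a fun x ↦ Kerr.radius a (poincareInv Λ c x)).time :=
    (PiLp.continuous_apply 2 _ 0).comp (continuous_poincareInv Λ c)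
  have hrc :
      Continuous (starBackground Λ c M a fun x ↦ Kerr.radius a (poincareInv Λ c x)).radius :=
    (Kerr.continuous_radius a).comp (continuous_poincareInv Λ c)
  -- the star domain is invariant under translation by `Λ∂₀`
  have hdom : ∀ x ∈ ((starBackground Λ c M a fun x ↦ Kerr.radius a (poincareInv Λ c x)).domain :
      Set E4), ∀ s : ℝ, x + s • (Λ : E4 ≃L[ℝ] E4) (EuclideanSpace.single (0 : Fin 4) (1 : ℝ)) ∈
        ((starBackground Λ c M a fun x ↦ Kerr.radius a (poincareInv Λ c x)).domain : Set E4) :=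
    add_smul_mem_starBackground_domain Λ c M a _
  -- the star deviation is `C^∞`, hence `C^{k+1}`, on the star domain
  have hh : ContDiffOn ℝ (k + 1)
      (𝓢.deviationExtend (starBackground Λ c M a fun x ↦ Kerr.radius a (poincareInv Λ c x)) Ψ)
      ((starBackground Λ c M a fun x ↦ Kerr.radius a (poincareInv Λ c x)).domain : Set E4) :=
    (contDiffOn_deviationExtend_star 𝓢 hΨ).of_le (by exact_mod_cast le_top)
  -- tameness along `Λ∂₀` on compacts of the star domain: the translates of a compact `K` by all
  -- late times lie in ONE star truncated late region, where the finite sup norm applies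
  have htame : ∀ K ⊆ ((starBackground Λ c M a fun x ↦ Kerr.radius a (poincareInv Λ c x)).domain :
      Set E4), IsCompact K → ∃ C t₁ : ℝ, ∀ t : ℝ, t₁ ≤ t → ∀ i, i ≤ k + 1 → ∀ z ∈ K,
        ‖iteratedFDeriv ℝ i
          (𝓢.deviationExtend (starBackground Λ c M a fun x ↦ Kerr.radius a (poincareInv Λ c x)) Ψ)
          (z + t • (Λ : E4 ≃L[ℝ] E4) (EuclideanSpace.single (0 : Fin 4) (1 : ℝ)))‖ ≤ C := by
    intro K hKO hK
    obtain ⟨t₀, ht₀⟩ := hK.bddBelow_image htc.continuousOn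
    obtain ⟨R₀, hR₀⟩ := hK.bddAbove_image hrc.continuousOn
    refine ⟨_, τ₀ - t₀ + 1, fun t ht i hi z hz ↦
      norm_iteratedFDeriv_le_toReal_supCkENorm hi ?_ _ (hfin R₀)⟩
    refine ⟨⟨z + t • (Λ : E4 ≃L[ℝ] E4) (EuclideanSpace.single (0 : Fin 4) (1 : ℝ)),
      hdom z (hKO hz) t⟩, ⟨?_, ?_⟩, rfl⟩
    · have h1 : t₀ ≤ (starBackground Λ c M a fun x ↦ Kerr.radius a (poincareInv Λ c x)).time z :=
        ht₀ (mem_image_of_mem _ hz)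
      show τ₀ < (starBackground Λ c M a fun x ↦ Kerr.radius a (poincareInv Λ c x)).time
        (z + t • (Λ : E4 ≃L[ℝ] E4) (EuclideanSpace.single (0 : Fin 4) (1 : ℝ)))
      rw [htime]
      linarith
    · have h2 : (starBackground Λ c M a fun x ↦ Kerr.radius a (poincareInv Λ c x)).radius z ≤ R₀ :=
        hR₀ (mem_image_of_mem _ hz)
      show (starBackground Λ c M a fun x ↦ Kerr.radius a (poincareInv Λ c x)).radius
        (z + t • (Λ : E4 ≃L[ℝ] E4) (EuclideanSpace.single (0 : Fin 4) (1 : ℝ))) ≤ R₀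
      rwa [hrad]
  -- Hale: a one-point ω-limit set is the limit
  exact tendsto_supCkENorm_translate_of_forall_omegaLimit_eq_zero
    (starBackground Λ c M a fun x ↦ Kerr.radius a (poincareInv Λ c x)).domain.isOpen hdom hh htame
    huniq

/-! ### Crux level: tame star era charts all of whose ω-limits vanish recur -/

/-- **Crux-level rider: star era charts with margin whose star deviations have ONLY the zero
`Cᵏ_loc` ω-limit recur.** Let `𝒟` be a vacuum maximal development carrying the data of
`Recurs k 𝒟` — a region `O`, `N` sub-extremal labels `(Mᵢ, aᵢ)` with motions `moᵢ = (Λᵢ, cᵢ)`, a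
late time `τ₀`, hole charts which are late charts for the exterior backgrounds
`boostedKerrBackground Λᵢ cᵢ Mᵢ aᵢ`, a late flat chart `Ψ₀` on `U₀`, sublinear tubes `ρᵢ`,
exhaustion radii `Rᵢ → ∞`, the tube complement inside `U₀`, separation of the holes at every radius,
`O = exteriorOf (charted)`, exhaustion of `O` at every chart time `τ₁ > τ₀` and the uniform `C⁰`
anchor (clauses 1–10 of `Recurs` verbatim, as in `recurs_of_starCharts_of_omegaLimits_flat`) — in
which every hole chart is the RESTRICTION `Ψsᵢ ∘ ι` to the exterior of a SMOOTH chart `Ψsᵢ` on the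
horizon-penetrating star background `starBackground Λᵢ cᵢ Mᵢ aᵢ (x ↦ r_{aᵢ}(Λᵢ⁻¹(x − cᵢ)))`. Suppose
(tame) every star deviation `dev★ᵢ = Ψsᵢ^* g − g_{Mᵢ,aᵢ,Λᵢ,cᵢ}` has finite `C^{k+1}` sup norm over
every star truncated late region `{t*ᵢ > τ₀, r ≤ R}`; (zero limits) for every hole, every `Cᵏ_loc`
ω-limit of the translates `dev★ᵢ (· + Tₙ • Λᵢ∂₀)`, `Tₙ → +∞`, vanishes on the star domain ("the only
dark limit is the reference Kerr"); and (flat recurrence) along SOME `T n → ∞` the flat chart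
recurs in `Cᵏ`, `deviationCk (Minkowski.backgroundOn U₀) Ψ₀ k (T n) → 0`. THEN `𝒟` recurs at
order `k`. Proof: by `tendsto_supCkENorm_starHole_translate_of_forall_omegaLimit_eq_zero` every
`dev★ᵢ` tends to `0` in `Cᵏ` on every compact of its star domain as `t → +∞` through the reals, a
fortiori along `T`; so along `T` every hole has the ω-limit `gᵢ = 0`, trivially `Cᵏ` and flat to
every order on the time-zero exterior slab, and `recurs_of_starCharts_of_omegaLimits_flat`
(`…RecursOfStarEra`) concludes. The LaSalle reading of the recur-disjunct for era charts with
margin, with the identification step ISOLATED as the hypothesis "zero limits" (Hale 1980, Ch. I,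
§8, Thm. 8.1). [cite: Hale1980, Ch. I §8 Thm. 8.1] -/
theorem recurs_of_starCharts_of_forall_omegaLimit_eq_zero :
    ∀ {X : Type} [TopologicalSpace X] [ChartedSpace E3 X] [IsManifold (𝓡 3) ∞ X]
      [ConnectedSpace X] {D : InitialDataSet (𝓡 3) X} (k : ℕ) (𝒟 : VacuumCauchyDevelopment D)
      (O : Set 𝒟.carrier) (N : ℕ) (M a : Fin N → ℝ) (mo : Fin N → lorentzGroup × E4) (τ₀ : ℝ)
      (Ψs : ∀ i, (starBackground (mo i).1 (mo i).2 (M i) (a i)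
        (fun x ↦ Kerr.radius (a i) (poincareInv (mo i).1 (mo i).2 x))).domain → 𝒟.carrier)
      (ρ R : Fin N → ℝ → ℝ) (U₀ : Opens E4) (Ψ₀ : U₀ → 𝒟.carrier),
      (∀ i, Kerr.IsSubextremal (M i) (a i)) →
      (∀ i, ContMDiff 𝓘(ℝ, E4) (𝓡 4) ∞ (Ψs i)) →
      (∀ i, 𝒟.toSpacetime.IsLateChart (boostedKerrBackground (mo i).1 (mo i).2 (M i) (a i)) O τ₀
        (Ψs i ∘ Opens.inclusion (boostedKerrExterior_le_starBackground_domain (mo i).1 (mo i).2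
          (M i) (a i) (fun x ↦ Kerr.radius (a i) (poincareInv (mo i).1 (mo i).2 x))))) →
      𝒟.toSpacetime.IsLateChart (Minkowski.backgroundOn U₀) O τ₀ Ψ₀ →
      (∀ i, Tendsto (fun t ↦ ρ i t / t) atTop (𝓝 0)) → (∀ i, Tendsto (R i) atTop atTop) →
      {x : E4 | τ₀ < x 0 ∧ ∀ i, ρ i (x 0) <
        Kerr.radius (a i) (poincareInv (mo i).1 (mo i).2 x)} ⊆ (U₀ : Set E4) →
      (∀ R' : ℝ, ∃ τ₁ : ℝ, Pairwise (Function.onFun Disjoint fun i ↦ (Ψs i ∘ Opens.inclusion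
          (boostedKerrExterior_le_starBackground_domain (mo i).1 (mo i).2 (M i) (a i)
            (fun x ↦ Kerr.radius (a i) (poincareInv (mo i).1 (mo i).2 x)))) ''
        (boostedKerrBackground (mo i).1 (mo i).2 (M i) (a i)).truncLateRegion τ₁ R')) →
      O = Summit.FinalStateConjecture.exteriorOf 𝒟.toCauchyDevelopment
        ((⋃ i, (Ψs i ∘ Opens.inclusion
            (boostedKerrExterior_le_starBackground_domain (mo i).1 (mo i).2 (M i) (a i)
              (fun x ↦ Kerr.radius (a i) (poincareInv (mo i).1 (mo i).2 x)))) ''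
          (boostedKerrBackground (mo i).1 (mo i).2 (M i) (a i)).lateRegion τ₀) ∪
          Ψ₀ '' (Minkowski.backgroundOn U₀).lateRegion τ₀) →
      (∀ τ₁ : ℝ, τ₀ < τ₁ → O \ (Ψ₀ '' (Minkowski.backgroundOn U₀).lateRegion τ₁ ∪
        ⋃ i, (Ψs i ∘ Opens.inclusion
            (boostedKerrExterior_le_starBackground_domain (mo i).1 (mo i).2 (M i) (a i)
              (fun x ↦ Kerr.radius (a i) (poincareInv (mo i).1 (mo i).2 x)))) ''
          {x | τ₁ < (boostedKerrBackground (mo i).1 (mo i).2 (M i) (a i)).time x.1 ∧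
            (boostedKerrBackground (mo i).1 (mo i).2 (M i) (a i)).radius x.1 ≤
              R i ((boostedKerrBackground (mo i).1 (mo i).2 (M i) (a i)).time x.1)}) ⊆
        𝒟.metric.causalPast 𝒟.timeOrientation (Ψ₀ '' (Minkowski.backgroundOn U₀).timeSlab τ₁ ∪
          ⋃ i, (Ψs i ∘ Opens.inclusion
            (boostedKerrExterior_le_starBackground_domain (mo i).1 (mo i).2 (M i) (a i)
              (fun x ↦ Kerr.radius (a i) (poincareInv (mo i).1 (mo i).2 x)))) ''
            (boostedKerrBackground (mo i).1 (mo i).2 (M i) (a i)).truncTimeSlab (R i τ₁) τ₁)) →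
      (∀ τ : ℝ, τ₀ < τ →
        𝒟.toSpacetime.deviationCk (Minkowski.backgroundOn U₀) Ψ₀ 0 τ ≤ ENNReal.ofReal (1 / 4) ∧
        ∀ i, 𝒟.toSpacetime.truncDeviationCk (boostedKerrBackground (mo i).1 (mo i).2 (M i) (a i))
          (Ψs i ∘ Opens.inclusion
            (boostedKerrExterior_le_starBackground_domain (mo i).1 (mo i).2 (M i) (a i)
              (fun x ↦ Kerr.radius (a i) (poincareInv (mo i).1 (mo i).2 x))))
          0 (R i τ) τ ≤ ENNReal.ofReal (1 / 4)) →
      (∀ i (Rr : ℝ), supCkENorm (Subtype.val '' (starBackground (mo i).1 (mo i).2 (M i) (a i)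
          (fun x ↦ Kerr.radius (a i) (poincareInv (mo i).1 (mo i).2 x))).truncLateRegion τ₀ Rr)
        (k + 1) (𝒟.toSpacetime.deviationExtend (starBackground (mo i).1 (mo i).2 (M i) (a i)
          (fun x ↦ Kerr.radius (a i) (poincareInv (mo i).1 (mo i).2 x))) (Ψs i)) ≠ ⊤) →
      (∀ i (g : E4 → E4 →L[ℝ] E4 →L[ℝ] ℝ) (T : ℕ → ℝ),
        ContDiffOn ℝ k g ((starBackground (mo i).1 (mo i).2 (M i) (a i)
          (fun x ↦ Kerr.radius (a i) (poincareInv (mo i).1 (mo i).2 x))).domain : Set E4) →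
        Tendsto T atTop atTop →
        (∀ K ⊆ ((starBackground (mo i).1 (mo i).2 (M i) (a i)
            (fun x ↦ Kerr.radius (a i) (poincareInv (mo i).1 (mo i).2 x))).domain : Set E4),
          IsCompact K →
          Tendsto (fun n ↦ supCkENorm K k (fun x ↦
            𝒟.toSpacetime.deviationExtend (starBackground (mo i).1 (mo i).2 (M i) (a i)
              (fun x ↦ Kerr.radius (a i) (poincareInv (mo i).1 (mo i).2 x))) (Ψs i)
              (x + T n • ((mo i).1 : E4 ≃L[ℝ] E4)
                (EuclideanSpace.single (0 : Fin 4) (1 : ℝ))) - g x)) atTop (𝓝 0)) →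
        ∀ x ∈ ((starBackground (mo i).1 (mo i).2 (M i) (a i)
            (fun x ↦ Kerr.radius (a i) (poincareInv (mo i).1 (mo i).2 x))).domain : Set E4),
          g x = 0) →
      (∃ T : ℕ → ℝ, Tendsto T atTop atTop ∧
        Tendsto (fun n ↦ 𝒟.toSpacetime.deviationCk (Minkowski.backgroundOn U₀) Ψ₀ k (T n)) atTop
          (𝓝 0)) →
      Recurs k 𝒟 := by
  intro X _ _ _ _ D k 𝒟 O N M a mo τ₀ Ψs ρ R U₀ Ψ₀ hsub hsmooth hlate hflat hρ hR hU₀ hsep hO hexh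
    hanchor hfin hzero hT
  obtain ⟨T, hT, hflatT⟩ := hT
  -- feed `recurs_of_starCharts_of_omegaLimits_flat` with `T` and, hole by hole, the ω-limit `0`
  refine recurs_of_starCharts_of_omegaLimits_flat k 𝒟 O N M a mo τ₀
    (fun i x ↦ Kerr.radius (a i) (poincareInv (mo i).1 (mo i).2 x)) Ψs ρ R U₀ Ψ₀ hsub hsmooth hlate
    hflat hρ hR hU₀ hsep hO hexh hanchor
    ⟨T, hT, hflatT, fun i ↦ ⟨fun _ ↦ 0, contDiffOn_const, fun K hKO hK ↦ ?_, fun x _ m _ ↦ ?_⟩⟩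
  · -- through the reals the translates tend to `0` in `Cᵏ` on `K`, a fortiori along `T`
    -- (`v - 0 = v` is fed to `simp` as a local fact: on the operator-norm tower
    -- `E4 →L[ℝ] E4 →L[ℝ] ℝ` the instance paths behind `sub_zero` agree only definitionally)
    have h0 : ∀ v : E4 →L[ℝ] E4 →L[ℝ] ℝ, v - 0 = v := fun v ↦ sub_zero v
    have hlim := (tendsto_supCkENorm_starHole_translate_of_forall_omegaLimit_eq_zero 𝒟.toSpacetime
      (mo i).1 (mo i).2 (M i) (a i) (hsmooth i) (hfin i) (hzero i) K hKO hK).comp hT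
    simpa only [Function.comp_def, h0] using hlim
  · -- the zero field is flat to every order
    simp only [iteratedFDeriv_fun_zero, Pi.zero_apply]

end Summit.FinalStateConjecture.FinalStateConjecture.Theorems.ClusterCompleteness

end
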